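import Literature.MathematicalPhysics.QuantumFieldTheory.Balaban1983to89.B8Thm4SupportLocal

/-!
# `Balaban1983to89.B8Prop3GaugeFixedKLevelSrc` — [Balaban1985RegularSpaces] Sect. H, p. 101 «Inspecting the proofs of the theorems and
# propositions we can see easily that they work in this more general situation almost without any changes, only some constants change their
# numerical values»: PROPOSITION 3's RESET (1.59) ⇒ (1.62) WITH AN ADDITIVE SOURCE TERM in the in-edge (1.59), and THEOREM 4's EXISTENCE
# INDUCTION AT ALL LEVELS FOR AN ARBITRARY GAUGE PREDICATE `Lan` with that reset — the first brick of Theorem 8's (f-sourced Landau gauge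
# (1.146) «R(U₀)D^{η*}_{U₀}A = f») existence clause on the concrete `ℤᵈ × 𝔸` carriers

statement-level skeleton of published theorems with citation tags; proofs where landed; nothing here is a claim about the Yang–Mills mass gap

T. Bałaban, *Spaces of regular gauge field configurations on a lattice and gauge fixing conditions*, Commun. Math. Phys. **99** (1985) 75–102
`[Balaban1985RegularSpaces]` ("B8"; journal page = PDF page + 74; PDF held `paper:balaban1985-cmp99-regular-spaces-gauge-fixing`): Prop. 3 p. 87
with (1.55)–(1.62) pp. 86–87, Theorem 4 p. 88 with its proof pp. 88–95, Sect. H p. 101 (Theorem 8, (1.146)); [4] = [Balaban1985BackgroundPropagators].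

## THE PRINTED TEXT (p. 101 [PDF 27], verbatim; p. 86 for the bootstrap)

p. 101: *"Finally let us remark that instead of Landau gauge condition (1.27), (1.38), we may consider a more general condition of the form
R(U₀)D^{η*}_{U₀}A = f, (1.146) where f is a function from the space R(U₀) … Of course we have to assume that f is in a sufficiently small
neighborhood of 0, for example it is enough to assume that |f|₍₋₂₎ < γ(α₀ + α₁) with a positive, not too big, constant γ, e.g. γ = 1.
Inspecting the proofs of the theorems and propositions we can see easily that they work in this more general situation almost without any
changes, only some constants change their numerical values. Thus we have the following generalization of Theorem 2. **Theorem 8.** …"*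
p. 86 (the bootstrap of Prop. 3): *"(1.55) contains |∇^η_{U₀}A|₍₋₂₎ … multiplied by B₀36dα₂ … e.g. B₀36dα₂ ≤ ½"*.

## WHY THIS FILE (cell `pub-ymgap`, HUMAN RULING D-0062; R134 seat `pub-ymgap-dag-n05-c` g4, DAG node N05 = [B8]; count-neutral)

The N05 knit of record displays THEOREM 8 in its surviving form `t8S : B8Thm8Surviving.Thm8SurvivingAt 1 …` as a printed HYPOTHESIS.  Theorem 4's
existence induction on the concrete carriers is already GENERIC in the gauge predicate `Lan m W` (`B8Thm4InductionLocal.thm4_exists_all_levels`,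
`B8Thm4SupportLocal.thm4_exists_all_levels_supp`, n04-b's `B8Prop3GaugeFixedKLevel.hP3_gaugeFixed_of_b9`, `B8Eq142KLevelLocal.H42_of_inAx`), so
Theorem 8's existence chain is «`Lan m W := IsLandau146W … f W`» — EXCEPT that the in-edge (1.59) of Proposition 3's reset (the socket `H59`,
[4] Thm 3.3 + (1.57)–(1.58): `|A|₍₋₁₎, |∇A|₍₋₂₎ ≤ B₀(|J|₍₋₃₎ + sup|Q A|)`) has NO source term, whereas for `R(U₀)D*A = f` the representation
(1.57) carries `+ G(U₀)…f`, i.e. an additive `|f|`-contribution: at `Lan := IsLandau146W f`, `f ≠ 0`, the landed socket would be a binder without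
honest provider (located on the cell bus, INBOX 2026-08-27 [DAGN05C-G4-LANDED-1]).  THIS FILE threads an ADDITIVE SOURCE TERM through the reset —
print's «only some constants change their numerical values» for Proposition 3 inside Theorem 4's induction:

* §1 `apriori_160_src` — the real-arithmetic bootstrap (1.55) + (1.56) + (1.59) ⇒ (1.60) of `B8.apriori_160` with (1.59) carrying `+ S_a`
  (the `|A|`-line) and `+ S_g` (the gradient line): `a ≤ [printed (1.60) bound] + S_a + S_g`, `g ≤ [printed] + 2S_g` (p. 86's `B₀36dα₂ ≤ ½`
  absorbs the gradient's source once more into the `|A|`-line).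
* §2 `prop3_normA_kLevel_src` — n05-b's `B8Prop3KLevel.prop3_norms_kLevel` (Prop. 3 in norm form at `k` levels, general background and family)
  for the `|A|`- and gradient lines with the sourced (1.59): conclusion `a ≤ 5dLB₀(α₀ + α₁) + (S_a + S_g)`, `g ≤ 5dLB₀(α₀ + α₁) + 2S_g` — the
  companions `B8Eq155KLevelLocal.eq155_norm_kLevel_hermitian` ((1.55)), `B8Eq156KLevelLocal.wsup_B1_le_kLevel` ((1.56)), `B8.apriori_162`
  ((1.61) ⇒ (1.62)) BY NAME, unchanged.
* §3 `hP3_gaugeFixed_of_b9_src` — n04-b's `hP3_gaugeFixed_of_b9` VERBATIM (the masked exponent device §3 of that file by name) with the in-edge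
  `H59src` carrying `+ T_a`, `+ T_g` (constants uniform in the level `m` and the gauge-fixed field) and the reset constant ANY `c⋆ ≥ 5dLB₀(α₀ + α₁)
  + T_a + T_g` (`hc` an inequality; every window stays stated in `c⋆`).
* §4 `thm4_exists_all_levels_supp_src` — `B8Thm4SupportLocal.thm4_exists_all_levels_supp` (gauge transformations carried by `Ω₀`, ARBITRARY
  `Lan`) with its socket `hP3` served by §3 and the (1.42) clause by `B8Eq142KLevelLocal.H42_of_inAx`: for every `m ≤ k` a unitary `u`, `= 1` off
  `Ω₀`, with (1.29) at `m` levels, `U′^{u⁻¹}` satisfying `Lan m` and the (1.62)-shape `|A| ≤ c⋆(Lʲη)⁻¹` on the bonds of `Ω_j`, `j ≤ m` — MODULO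
  Prop. 5's sockets `hP5base`/`hP5` AT `Lan` (for Theorem 8: Proposition 5 for the sourced equation — honest binders, their premiss is `Lan m U₁`)
  and the sourced in-edge `H59src`.  At `T_a = T_g = 0`, `Lan := IsLandau138W` this is `thm4_exists_all_levels_supp_landau138` again (up to
  `hc`'s shape); at `Lan := IsLandau146W … f` it is THEOREM 8's existence core ((1.146) + (1.62); (1.37) then follows by `H42_of_inAx` as for
  Theorem 4, cf. `B8LeafModelZd3.thm4Printed_zd3`).
* §5 `thm4_unique_leafShape_lan`, `thm4_unique_eq_lan` — the uniqueness clause («exactly one», Thm 4 p. 88 ∕ Thm 8 p. 101) for an ARBITRARY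
  `Lan`: `B8Thm4AtLandau138.thm4_unique_leafShape_landau138` ∕ `B8Thm4SupportLocal.thm4_unique_eq_landau138` VERBATIM with `Lan` a parameter
  (the underlying `B8Thm4UniqueLocal.thm4_unique_of_agree` is `Lan`-generic; the gauge condition is consumed only by Prop. 5's uniqueness
  socket `hP5u`, whose premisses now read `Lan (…)` — for Theorem 8: two restricted solutions of the SAME sourced equation).

## HONEST SCOPE

Real arithmetic + the two cited k-level estimates and n04-b's device BY NAME; NO new estimate of [Balaban1985RegularSpaces] or [4]; the source
constants `S_a, S_g, T_a, T_g` are free non-negative reals (for Theorem 8 the provider of `H59src` reads them as `B₀γ′|f|₍₋₂₎`-type quantities —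
[4] Thm 3.3 applied to (1.57) with the source; NOT done here); Prop. 5 with source (the providers of `hP5base`∕`hP5`∕`hP5u` at `Lan := IsLandau146W f`) and the `zdGF3`
assembly of `Thm8SurvivingAt` are NOT in this file (located: `B8Thm4Concrete` ∕ `B8LeafModelZd3Thm2` twins).
`d ≥ 2`; `T_η ↦ ℤᵈ`; `≤` for print's `<`.  Count-neutral; N05 NOT discharged; one finite `T⁴` programme at fixed `ε`, Bałaban as printed —
nothing continuum ∕ ℝ⁴ ∕ OS ∕ mass-gap ∕ Clay.  No `sorry`, no `axiom`, no definition, no `instance`.  Unit `pub-ymgap-dag-n05-c` (g4), 2026-08-27.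

[cite: Balaban1985RegularSpaces, Thm 8 (1.146) p.101, Prop. 3 (1.55)–(1.62) pp.86–87, Thm 4 p.88, pp.94–95; Balaban1985BackgroundPropagators, Thm 3.3 p.398]
-/

noncomputable section

open NormedSpace

namespace Literature.MathematicalPhysics.QuantumFieldTheory.Balaban1983to89.B8Prop3GaugeFixedKLevelSrc

open Complex (I I_ne_zero)
open MatrixLog B7Prop1Explicit B7Prop2Explicit B7Prop1Local B7Eq92Concrete
open B7Prop2Explicit (C0 c2' unitaryUnits unitaryUnits_le_U1 avgClosed_unitaryUnits)
open B8Lemma1NonAbelian (mulCfg)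
open B8Ineq132 (covDerivFwd covDeriv covDiv plaqF InAk CondAt BondTouches PlaqTouches)
open B8Eq140Level (SideTouches)
open B8Eq119TwistedAxial (Restr129 InAx)
open B8Eq184Proof (gaugeExp cfgExp)
open B8Eq146AExpansion (iEta expCfg)
open B7Prop4GeneralLevels (logCovIter linCovIter)
open B8Eq155JBound (Jcur wsup)
open B8ScaledSupNorm (bondNorm msup weight Bdd)
open B7Prop3Flat (c3)
open B7Eq78Linearization (conjR)
open B8Thm2LogB (blockTop)
open B8Ineq130 (tlo thi)
open B8Eq155KLevelLocal (eq155_norm_kLevel_hermitian)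
open B8Eq156KLevelLocal (wsup_B1_le_kLevel)
open B8Prop3KLevel (bound_of_sideTouches)
open B8Prop3GaugeFixedKLevel (logField_spec mem_unitaryUnits_of_mgauge_eq cfgExp_congr_at inAk_congr_of_sideTouches
  mulCfg_eq_gaugeAct_of_mgauge_eq expCfg_iEta_eq_cfgExp)
open B8Thm4SupportLocal (thm4_exists_all_levels_supp)
open B8Thm4UniqueLocal (thm4_unique_of_agree)
open B8Thm4AtLandau138 (pdevOn_tower_lt_of_inAk mgauge_mgauge_inv)
open B8Eq140Level (sideTouches_of_bondTouches)

-- `Site` alone could resolve to the torus sites of `Setup.lean`; re-export the `ℤ^d` sites of `B7Prop1Explicit`.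
export B7Prop1Explicit (Site)

variable {d : ℕ}

/-! ## §1 The bootstrap (1.55) + (1.56) + (1.59) ⇒ (1.60) with an additive source term in (1.59) -/

/-- **(1.55) + (1.56) + (1.59)-with-source ⇒ (1.60)-with-source** (real arithmetic; `B8.apriori_160` is the case `S_a = S_g = 0`): if the
`|A|`-quantity `a` and the gradient quantity `g ≥ 0` satisfy `a ≤ B₀(n_J + n_B) + S_a`, `g ≤ B₀(n_J + n_B) + S_g`, with (1.55)
`n_J ≤ 2α₀ + 36dα₂·g + 50dα₂³ + 10dα₀α₂`, (1.56) `n_B ≤ 2dLα₁ + C₂α₂²`, and p. 86's `B₀36dα₂ ≤ ½`, `50dα₂ ≤ 1`, then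
`a ≤ B₀(4α₀ + 4dLα₁ + 2α₂² + 20dα₀α₂ + 2C₂α₂²) + S_a + S_g` and `g ≤ B₀(…) + 2S_g`.
[cite: Balaban1985RegularSpaces, (1.55)–(1.60) pp.86–87; Thm 8 p.101 («only some constants change»)] -/
theorem apriori_160_src {d L C₂ B₀ α₀ α₁ α₂ nJ nB a g Sa Sg : ℝ}
    (hd : 0 ≤ d) (hB₀ : 0 ≤ B₀) (hα₂ : 0 ≤ α₂) (hg : 0 ≤ g)
    (h55 : nJ ≤ 2 * α₀ + 36 * d * α₂ * g + 50 * d * α₂ ^ 3 + 10 * d * α₀ * α₂)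
    (h56 : nB ≤ 2 * d * L * α₁ + C₂ * α₂ ^ 2)
    (h59a : a ≤ B₀ * (nJ + nB) + Sa) (h59g : g ≤ B₀ * (nJ + nB) + Sg)
    (hside : 36 * d * B₀ * α₂ ≤ 1 / 2) (h50 : 50 * d * α₂ ≤ 1) :
    a ≤ B₀ * (4 * α₀ + 4 * d * L * α₁ + 2 * α₂ ^ 2 + 20 * d * α₀ * α₂ + 2 * C₂ * α₂ ^ 2) + Sa + Sg ∧
    g ≤ B₀ * (4 * α₀ + 4 * d * L * α₁ + 2 * α₂ ^ 2 + 20 * d * α₀ * α₂ + 2 * C₂ * α₂ ^ 2) + 2 * Sg := by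
  set Y := 2 * α₀ + 50 * d * α₂ ^ 3 + 10 * d * α₀ * α₂ + nB with hY
  have hJB : nJ + nB ≤ Y + 36 * d * α₂ * g := by rw [hY]; linarith
  have hstep : B₀ * (nJ + nB) ≤ B₀ * Y + 36 * d * B₀ * α₂ * g := by
    have := mul_le_mul_of_nonneg_left hJB hB₀
    linarith [this]
  have hθg : 36 * d * B₀ * α₂ * g ≤ (1 / 2) * g := by
    have := mul_le_mul_of_nonneg_right hside hg
    linarith [this]
  -- bootstrap for the gradient quantity, then the `|A|`-line
  have hg2 : g ≤ 2 * (B₀ * Y) + 2 * Sg := by linarith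
  have ha2 : a ≤ 2 * (B₀ * Y) + Sa + Sg := by linarith
  have hdα : 0 ≤ d * α₂ := mul_nonneg hd hα₂
  have hcube : 100 * d * α₂ ^ 3 ≤ 2 * α₂ ^ 2 := by nlinarith [sq_nonneg α₂, hdα]
  have hfin : 2 * (B₀ * Y) ≤
      B₀ * (4 * α₀ + 4 * d * L * α₁ + 2 * α₂ ^ 2 + 20 * d * α₀ * α₂ + 2 * C₂ * α₂ ^ 2) := by
    have hin : 2 * Y ≤ 4 * α₀ + 4 * d * L * α₁ + 2 * α₂ ^ 2 + 20 * d * α₀ * α₂ + 2 * C₂ * α₂ ^ 2 := by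
      rw [hY]; linarith
    have := mul_le_mul_of_nonneg_left hin hB₀
    linarith [this]
  exact ⟨by linarith, by linarith⟩

/-! ## §2 Proposition 3 in norm form at `k` levels with the sourced (1.59): the `|A|`- and gradient lines -/

section Prop3

variable {𝔸 : Type*} [CStarAlgebra 𝔸] [Nontrivial 𝔸]

/-- **PROPOSITION 3 IN NORM FORM AT `k` LEVELS WITH A SOURCED (1.59)** — n05-b's `B8Prop3KLevel.prop3_norms_kLevel` for the `|A|`-quantity
`a` and the gradient quantity `g` when the in-edge (1.59) carries additive source terms `S_a, S_g ≥ 0` (print p. 101: for the sourced gauge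
condition (1.146) «only some constants change their numerical values»): same hypotheses — (1.40) for `U₀` and `e^{iηA}U₀`, (1.41) on the sides
touching `Ω_j`, the gradient datum, (1.42) on the constraint bonds, the windows and (1.61) — and conclusions `a ≤ 5dLB₀(α₀ + α₁) + (S_a + S_g)`,
`g ≤ 5dLB₀(α₀ + α₁) + 2S_g`.  Proof = the original's: (1.55) `B8Eq155KLevelLocal.eq155_norm_kLevel_hermitian`, (1.56)
`B8Eq156KLevelLocal.wsup_B1_le_kLevel`, the sourced bootstrap `apriori_160_src`, (1.61) ⇒ (1.62) `B8.apriori_162`.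
[cite: Balaban1985RegularSpaces, Prop. 3 p.87, (1.55)–(1.62) pp.86–87, Thm 8 p.101] -/
theorem prop3_normA_kLevel_src (hd2 : 2 ≤ d) {η : ℝ} (hη : 0 < η) {L : ℕ} (hL : 2 ≤ L) {k : ℕ}
    {U₀ : Site d → Fin d → 𝔸ˣ} (hU₀ : ∀ y κ, U₀ y κ ∈ unitaryUnits 𝔸)
    {A : Site d → Fin d → 𝔸} (hAh : ∀ y κ, IsSelfAdjoint (A y κ)) {α₀ α₁ α₂ g : ℝ}
    (hα₀ : 0 < α₀) (hα₁ : 0 ≤ α₁) (hα₂ : 0 ≤ α₂) (hg0 : 0 ≤ g)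
    (hα3 : C0 d * α₀ ≤ 1 / 3) (hα4 : 4 * α₀ ≤ c2' d L) (h16 : 16 * α₂ ≤ 1) (hd5 : 5 * α₂ * ((d : ℝ) - 1) ≤ 4)
    (hsmall : Real.exp (4 * (800 * ((d : ℝ) + 1) ^ 2 * ((d : ℝ) + 4)) * α₀)
      * (1 + 8 * (131072 * ((d : ℝ) + 1) ^ 2) * α₂) ≤ 2)
    (hc₃ : 2 * α₂ ≤ c3 d L) {B₀ : ℝ} (hB₀ : 0 ≤ B₀) (hside : 36 * d * B₀ * α₂ ≤ 1 / 2) (h50 : 50 * d * α₂ ≤ 1)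
    {C₂ : ℝ} (hC₂ : 8 * (131072 * ((d : ℝ) + 1) ^ 2) * Real.exp (4 * (800 * ((d : ℝ) + 1) ^ 2 * ((d : ℝ) + 4)) * α₀) ≤ C₂)
    (h61 : 2 * α₂ ^ 2 + 20 * d * α₀ * α₂ + 2 * C₂ * α₂ ^ 2 ≤ α₀ + α₁)
    {Ω : ℕ → Set (Site d)} {Λ : ℕ → Set (Site d × Fin d)}
    (hbox : ∀ j, j ≤ k → ∀ c ∈ Λ j, ∀ x, InBox (loK L j c.1) (bondHiK L j c.1 c.2) x → x ∈ Ω j)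
    (h40₀ : InAk L k η α₀ Ω U₀) (h40₁ : InAk L k η α₀ Ω (mulCfg (expCfg (iEta η A)) U₀))
    (h41 : ∀ j, j ≤ k → ∀ y τ, SideTouches (Ω j) y τ → ‖A y τ‖ ≤ α₂ * ((L : ℝ) ^ j * η)⁻¹)
    (hg : ∀ j, j ≤ k → ∀ (y : Site d) (κ τ : Fin d), SideTouches (Ω j) y τ →
      ((L : ℝ) ^ j * η) ^ 2 * ‖covDerivFwd η U₀ κ (fun z => A z τ) y‖ ≤ g)
    (h42 : ∀ j, j ≤ k → ∀ c ∈ Λ j, ‖logCovIter L U₀ (iEta η A) j c.1 c.2‖ < 2 * d * L * α₁)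
    {a Sa Sg : ℝ}
    (h59a : a ≤ B₀ * (bondNorm L k η (-(3 : ℝ)) Ω (fun x μ => Jcur η U₀ A μ x)
      + wsup 1 (fun p : {p : ℕ × (Site d × Fin d) // p.1 ≤ k ∧ p.2 ∈ Λ p.1} =>
          linCovIter L U₀ (iEta η A) p.1.1 p.1.2.1 p.1.2.2)) + Sa)
    (h59g : g ≤ B₀ * (bondNorm L k η (-(3 : ℝ)) Ω (fun x μ => Jcur η U₀ A μ x)
      + wsup 1 (fun p : {p : ℕ × (Site d × Fin d) // p.1 ≤ k ∧ p.2 ∈ Λ p.1} =>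
          linCovIter L U₀ (iEta η A) p.1.1 p.1.2.1 p.1.2.2)) + Sg) :
    a ≤ 5 * d * L * B₀ * (α₀ + α₁) + (Sa + Sg) ∧ g ≤ 5 * d * L * B₀ * (α₀ + α₁) + 2 * Sg := by
  have hL1 : 1 ≤ L := le_trans (by norm_num) hL
  have h₀ : ∀ y κ, U₀ y κ ∈ U1 𝔸 := fun y κ => unitaryUnits_le_U1 (hU₀ y κ)
  -- (1.55) at `k` levels (`B8Eq155KLevelLocal`)
  have h55 := eq155_norm_kLevel_hermitian hη hL1 h₀ hAh hα₀.le hα₂ h16 hd5 hg0 h40₀ h40₁ h41 hg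
  -- (1.56) at `k` levels (`B8Eq156KLevelLocal`), with (1.41) moved to the bonds touching `Ω_j`
  have h41' : ∀ j, j ≤ k → ∀ x μ, BondTouches (Ω j) x μ → ‖A x μ‖ ≤ α₂ * ((L : ℝ) ^ j * η)⁻¹ :=
    fun j hj x μ hb => bound_of_sideTouches hd2 (h41 j hj) x μ hb
  have h56 := wsup_B1_le_kLevel hη L hL (avgClosed_unitaryUnits d L) U₀ hU₀ hα₀ hα3 hα4 A hα₂ hsmall hc₃ hbox h40₀
    h41' hα₁ h42
  -- the bootstrap (1.55) + (1.56) + (1.59) ⇒ (1.60), with `C₂(d, α₀)`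
  obtain ⟨ha, hg'⟩ := apriori_160_src (Nat.cast_nonneg d) hB₀ hα₂ hg0 h55 h56 h59a h59g hside h50
  -- `C₂(d, α₀) ≤ C₂`, so (1.60) holds with `C₂`
  set R₀ := B₀ * (4 * α₀ + 4 * d * L * α₁ + 2 * α₂ ^ 2 + 20 * d * α₀ * α₂
      + 2 * (8 * (131072 * ((d : ℝ) + 1) ^ 2) * Real.exp (4 * (800 * ((d : ℝ) + 1) ^ 2 * ((d : ℝ) + 4)) * α₀))
        * α₂ ^ 2) with hR₀
  set R₁ := B₀ * (4 * α₀ + 4 * d * L * α₁ + 2 * α₂ ^ 2 + 20 * d * α₀ * α₂ + 2 * C₂ * α₂ ^ 2) with hR₁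
  have hR : R₀ ≤ R₁ := by
    rw [hR₀, hR₁]
    apply mul_le_mul_of_nonneg_left _ hB₀
    have hsq : 0 ≤ α₂ ^ 2 := sq_nonneg _
    nlinarith [mul_le_mul_of_nonneg_right hC₂ hsq]
  -- (1.60) + (1.61) ⇒ (1.62) (`B8.apriori_162`)
  have hd' : (1 : ℝ) ≤ d := by exact_mod_cast (le_trans (by norm_num) hd2)
  have hdL : (1 : ℝ) ≤ (d : ℝ) * L := by
    have hL' : (1 : ℝ) ≤ L := by exact_mod_cast hL1
    nlinarith
  have h162 : R₁ ≤ 5 * d * L * B₀ * (α₀ + α₁) := by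
    rw [hR₁]
    exact B8.apriori_162 hB₀ hdL hα₀.le hα₁ h61
  exact ⟨by linarith [hR.trans h162], by linarith [hR.trans h162]⟩

end Prop3

/-! ## §3 The socket `hP3` of Theorem 4's induction with the SOURCED in-edge: the reset to any `c⋆ ≥ 5dLB₀(α₀ + α₁) + T_a + T_g` -/

section Reset

variable {𝔸 : Type*} [CStarAlgebra 𝔸] [Nontrivial 𝔸]

/-- **THE SOCKET `hP3` OF `B8Thm4InductionLocal.thm4_exists_all_levels` WITH A SOURCED IN-EDGE** — n04-b's
`B8Prop3GaugeFixedKLevel.hP3_gaugeFixed_of_b9` VERBATIM (statement, masked-exponent device, proof) except: the in-edge `H59src` bounds the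
`|A′|₍₋₁₎`-family by `B₀(|J|₍₋₃₎ + sup|Q A′|) + T_a` and the gradient family by `… + T_g` (`T_a, T_g ≥ 0` uniform in the level and the
gauge-fixed field — for Theorem 8 the `|f|`-contribution of [4] Thm 3.3 applied to (1.146)), and the reset constant is ANY `c⋆` with
`5dLB₀(α₀ + α₁) + T_a + T_g ≤ c⋆` (`hc`; the windows stay stated in `c⋆`).  CONCLUSION unchanged: for `1 ≤ m ≤ k` and gauge-fixed `(u, W, A)` with
`Lan m W` and `‖A_b‖ ≤ (2Lc⋆ + 8α₄)(Lʲη)⁻¹` on the sides touching `Ω_j`, `j ≤ m`: `‖A_b‖ ≤ c⋆(Lʲη)⁻¹` there.  Print p. 101: «only some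
constants change their numerical values». [cite: Balaban1985RegularSpaces, Prop. 3 p.87, (1.59)–(1.62) pp.86–87, Thm 4 p.88, p.95, Thm 8 p.101] -/
theorem hP3_gaugeFixed_of_b9_src (hd2 : 2 ≤ d) {η : ℝ} (hη : 0 < η) {L : ℕ} (hL : 2 ≤ L) (k : ℕ)
    {U₀ U' : Site d → Fin d → 𝔸ˣ} (hU₀ : ∀ x κ, U₀ x κ ∈ unitaryUnits 𝔸) (hU' : ∀ x κ, U' x κ ∈ unitaryUnits 𝔸)
    {α₀ α₁ α₄ B₀ cstar : ℝ} (hα₀ : 0 < α₀) (hα₁ : 0 ≤ α₁) (hα₄ : 0 ≤ α₄) (hB₀ : 0 ≤ B₀)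
    {Ta Tg : ℝ} (hTa : 0 ≤ Ta) (hTg : 0 ≤ Tg) (hc : 5 * d * L * B₀ * (α₀ + α₁) + (Ta + Tg) ≤ cstar)
    (hα3 : C0 d * α₀ ≤ 1 / 3) (hα4 : 4 * α₀ ≤ c2' d L)
    (h16 : 16 * (2 * (L * cstar) + 8 * α₄) ≤ 1) (hd5 : 5 * (2 * (L * cstar) + 8 * α₄) * ((d : ℝ) - 1) ≤ 4)
    (hsmall : Real.exp (4 * (800 * ((d : ℝ) + 1) ^ 2 * ((d : ℝ) + 4)) * α₀)
      * (1 + 8 * (131072 * ((d : ℝ) + 1) ^ 2) * (2 * (L * cstar) + 8 * α₄)) ≤ 2)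
    (hc₃ : 2 * (2 * (L * cstar) + 8 * α₄) ≤ c3 d L) (hside : 36 * d * B₀ * (2 * (L * cstar) + 8 * α₄) ≤ 1 / 2)
    (h50 : 50 * d * (2 * (L * cstar) + 8 * α₄) ≤ 1)
    {C₂ : ℝ} (hC₂ : 8 * (131072 * ((d : ℝ) + 1) ^ 2) * Real.exp (4 * (800 * ((d : ℝ) + 1) ^ 2 * ((d : ℝ) + 4)) * α₀) ≤ C₂)
    (h61 : 2 * (2 * (L * cstar) + 8 * α₄) ^ 2 + 20 * d * α₀ * (2 * (L * cstar) + 8 * α₄)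
      + 2 * C₂ * (2 * (L * cstar) + 8 * α₄) ^ 2 ≤ α₀ + α₁)
    (Ω : ℕ → Set (Site d)) (Λs : ℕ → ℕ → Set (Site d)) (Λb : ℕ → ℕ → Set (Site d × Fin d))
    (hbox : ∀ m, m ≤ k → ∀ j, j ≤ m → ∀ c ∈ Λb m j, ∀ x, InBox (loK L j c.1) (bondHiK L j c.1 c.2) x → x ∈ Ω j)
    (h33 : InAk L k η α₀ Ω U₀) (h34 : InAk L k η α₀ Ω (mulCfg U' U₀))
    (Lan : ℕ → (Site d → Fin d → 𝔸ˣ) → Prop)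
    (H42 : ∀ m, 1 ≤ m → m ≤ k → ∀ (u : Site d → 𝔸ˣ) (W : Site d → Fin d → 𝔸ˣ) (A' : Site d → Fin d → 𝔸),
      (∀ x, u x ∈ unitaryUnits 𝔸) → mgauge U₀ u W = U' → Restr129 L m (Λs m) U₀ u → Lan m W →
      (∀ y τ, IsSelfAdjoint (A' y τ)) →
      (∀ j, j ≤ m → ∀ y τ, SideTouches (Ω j) y τ →
        W y τ = cfgExp η A' y τ ∧ ‖A' y τ‖ ≤ (2 * (L * cstar) + 8 * α₄) * ((L : ℝ) ^ j * η)⁻¹) →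
      (∀ y τ, (∀ j, j ≤ m → ¬ SideTouches (Ω j) y τ) → A' y τ = 0) →
      ∀ j, j ≤ m → ∀ c ∈ Λb m j, ‖logCovIter L U₀ (iEta η A') j c.1 c.2‖ < 2 * d * L * α₁)
    (H59 : ∀ m, 1 ≤ m → m ≤ k → ∀ (u : Site d → 𝔸ˣ) (W : Site d → Fin d → 𝔸ˣ) (A' : Site d → Fin d → 𝔸),
      (∀ x, u x ∈ unitaryUnits 𝔸) → mgauge U₀ u W = U' → Restr129 L m (Λs m) U₀ u → Lan m W →
      (∀ y τ, IsSelfAdjoint (A' y τ)) →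
      (∀ j, j ≤ m → ∀ y τ, SideTouches (Ω j) y τ →
        W y τ = cfgExp η A' y τ ∧ ‖A' y τ‖ ≤ (2 * (L * cstar) + 8 * α₄) * ((L : ℝ) ^ j * η)⁻¹) →
      (∀ y τ, (∀ j, j ≤ m → ¬ SideTouches (Ω j) y τ) → A' y τ = 0) →
      msup L m η (-(1 : ℝ)) (fun j (b : Site d × Fin d) => SideTouches (Ω j) b.1 b.2) (fun b => A' b.1 b.2)
          ≤ B₀ * (bondNorm L m η (-(3 : ℝ)) Ω (fun x μ => Jcur η U₀ A' μ x)
            + wsup 1 (fun p : {p : ℕ × (Site d × Fin d) // p.1 ≤ m ∧ p.2 ∈ Λb m p.1} =>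
                linCovIter L U₀ (iEta η A') p.1.1 p.1.2.1 p.1.2.2)) + Ta ∧
        msup L m η (-(2 : ℝ)) (fun j (t : Fin d × Fin d × Site d) => SideTouches (Ω j) t.2.2 t.2.1)
            (fun t => covDerivFwd η U₀ t.1 (fun z => A' z t.2.1) t.2.2)
          ≤ B₀ * (bondNorm L m η (-(3 : ℝ)) Ω (fun x μ => Jcur η U₀ A' μ x)
            + wsup 1 (fun p : {p : ℕ × (Site d × Fin d) // p.1 ≤ m ∧ p.2 ∈ Λb m p.1} =>
                linCovIter L U₀ (iEta η A') p.1.1 p.1.2.1 p.1.2.2)) + Tg) :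
    ∀ m, 1 ≤ m → m ≤ k → ∀ (u : Site d → 𝔸ˣ) (W : Site d → Fin d → 𝔸ˣ) (A : Site d → Fin d → 𝔸),
      (∀ x, u x ∈ unitaryUnits 𝔸) → mgauge U₀ u W = U' → Restr129 L m (Λs m) U₀ u → Lan m W →
      (∀ j, j ≤ m → ∀ b ∈ {b : Site d × Fin d | SideTouches (Ω j) b.1 b.2},
        W b.1 b.2 = cfgExp η A b.1 b.2 ∧ ‖A b.1 b.2‖ ≤ (2 * (L * cstar) + 8 * α₄) * ((L : ℝ) ^ j * η)⁻¹) →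
      ∀ j, j ≤ m → ∀ b ∈ {b : Site d × Fin d | SideTouches (Ω j) b.1 b.2},
        ‖A b.1 b.2‖ ≤ cstar * ((L : ℝ) ^ j * η)⁻¹ := by
  intro m hm1 hmk u W A hu hW h129 hLan hWA j₀ hj₀ b₀ hb₀
  have hL1 : 1 ≤ L := le_trans (by norm_num) hL
  have hLr : (1 : ℝ) ≤ L := by exact_mod_cast hL1
  set α₂ : ℝ := 2 * (L * cstar) + 8 * α₄ with hα₂_def
  have hcstar : 0 ≤ cstar := le_trans (by positivity) hc
  have hα₂ : 0 ≤ α₂ := by positivity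
  have hα₂16 : α₂ ≤ 1 / 16 := by linarith
  -- `W` is unitary-valued
  have hWu : ∀ x κ, W x κ ∈ unitaryUnits 𝔸 := mem_unitaryUnits_of_mgauge_eq hU₀ hU' hu hW
  -- the bonds where the socket delivers `W = e^{iηA}`
  set M : Set (Site d × Fin d) := {b | ∃ j, j ≤ m ∧ SideTouches (Ω j) b.1 b.2} with hM_def
  -- the masked exponent field `A′ := (1/iη) log W` on `M`, `0` elsewhere
  set A' : Site d → Fin d → 𝔸 :=
    fun y τ => M.indicator (fun b : Site d × Fin d => η⁻¹ • ((I⁻¹ : ℂ) • mlog ((W b.1 b.2 : 𝔸ˣ) : 𝔸))) (y, τ) with hA'_def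
  -- on a socket bond: `A′ = A`, self-adjoint, `W = e^{iηA′}`
  have hsock : ∀ j, j ≤ m → ∀ y τ, SideTouches (Ω j) y τ →
      A' y τ = A y τ ∧ IsSelfAdjoint (A' y τ) ∧ W y τ = cfgExp η A' y τ := by
    intro j hj y τ hs
    have hmem : (y, τ) ∈ M := ⟨j, hj, hs⟩
    obtain ⟨hWA₁, hA₁⟩ := hWA j hj (y, τ) hs
    have hLj : (1 : ℝ) ≤ (L : ℝ) ^ j := one_le_pow₀ hLr
    have hA₂ : ‖A y τ‖ ≤ α₂ * η⁻¹ := by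
      calc ‖A y τ‖ ≤ α₂ * ((L : ℝ) ^ j * η)⁻¹ := hA₁
        _ = α₂ * η⁻¹ * ((L : ℝ) ^ j)⁻¹ := by rw [mul_inv]; ring
        _ ≤ α₂ * η⁻¹ * 1 := by
            apply mul_le_mul_of_nonneg_left (inv_le_one_of_one_le₀ hLj) (by positivity)
        _ = α₂ * η⁻¹ := mul_one _
    obtain ⟨hlog, hsa, hexp⟩ := logField_spec hη U₀ hWu hWA₁ hA₂ hα₂16
    have hA'y : A' y τ = η⁻¹ • ((I⁻¹ : ℂ) • mlog ((W y τ : 𝔸ˣ) : 𝔸)) := by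
      simp only [hA'_def, Set.indicator_of_mem hmem]
    refine ⟨by rw [hA'y, hlog], by rw [hA'y]; exact hsa, ?_⟩
    rw [hexp]
    exact cfgExp_congr_at η hA'y.symm
  have hA'0 : ∀ y τ, (∀ j, j ≤ m → ¬ SideTouches (Ω j) y τ) → A' y τ = 0 := by
    intro y τ h
    have hnot : (y, τ) ∉ M := fun ⟨j, hj, hs⟩ => h j hj hs
    simp only [hA'_def, Set.indicator_of_notMem hnot]
  have hA'sa : ∀ y τ, IsSelfAdjoint (A' y τ) := by
    intro y τ
    by_cases hmem : (y, τ) ∈ M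
    · obtain ⟨j, hj, hs⟩ := hmem
      exact (hsock j hj y τ hs).2.1
    · have : A' y τ = 0 := by simp only [hA'_def, Set.indicator_of_notMem hmem]
      rw [this]; exact IsSelfAdjoint.zero 𝔸
  have hA'41 : ∀ j, j ≤ m → ∀ y τ, SideTouches (Ω j) y τ →
      W y τ = cfgExp η A' y τ ∧ ‖A' y τ‖ ≤ α₂ * ((L : ℝ) ^ j * η)⁻¹ := by
    intro j hj y τ hs
    obtain ⟨hAA, -, hWe⟩ := hsock j hj y τ hs
    exact ⟨hWe, by rw [hAA]; exact (hWA j hj (y, τ) hs).2⟩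
  -- global bound `‖A′‖ ≤ α₂η⁻¹`
  have hA'glob : ∀ y τ, ‖A' y τ‖ ≤ α₂ * η⁻¹ := by
    intro y τ
    by_cases hmem : (y, τ) ∈ M
    · obtain ⟨j, hj, hs⟩ := hmem
      have hLj : (1 : ℝ) ≤ (L : ℝ) ^ j := one_le_pow₀ hLr
      calc ‖A' y τ‖ ≤ α₂ * ((L : ℝ) ^ j * η)⁻¹ := (hA'41 j hj y τ hs).2
        _ = α₂ * η⁻¹ * ((L : ℝ) ^ j)⁻¹ := by rw [mul_inv]; ring
        _ ≤ α₂ * η⁻¹ * 1 := by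
            apply mul_le_mul_of_nonneg_left (inv_le_one_of_one_le₀ hLj) (by positivity)
        _ = α₂ * η⁻¹ := mul_one _
    · have : A' y τ = 0 := by simp only [hA'_def, Set.indicator_of_notMem hmem]
      rw [this, norm_zero]; positivity
  -- the in-edge (1.59) and the (1.42) clause for `A′`
  obtain ⟨h59a, h59g⟩ := H59 m hm1 hmk u W A' hu hW h129 hLan hA'sa hA'41 hA'0
  have h42 := H42 m hm1 hmk u W A' hu hW h129 hLan hA'sa hA'41 hA'0
  -- (1.40) for `U₀` and for `e^{iηA′}U₀` at the `m` levels
  have h40₀ : InAk L m η α₀ Ω U₀ := fun j hj => h33 j (hj.trans hmk)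
  have h40W : InAk L m η α₀ Ω (mulCfg W U₀) := by
    have h1 : InAk L m η α₀ Ω (mulCfg U' U₀) := fun j hj => h34 j (hj.trans hmk)
    have hui : ∀ x, u⁻¹ x ∈ U1 𝔸 := fun x => unitaryUnits_le_U1 ((unitaryUnits 𝔸).inv_mem (hu x))
    rw [mulCfg_eq_gaugeAct_of_mgauge_eq hW]
    exact (B8Ineq132.inAk_gaugeAct_iff L m η α₀ Ω hui _).2 h1
  have h40₁ : InAk L m η α₀ Ω (mulCfg (expCfg (iEta η A')) U₀) := by
    refine (inAk_congr_of_sideTouches L m η α₀ (V := mulCfg W U₀) fun j hj y τ hs => ?_).1 h40W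
    show W y τ * U₀ y τ = expCfg (iEta η A') y τ * U₀ y τ
    rw [(hA'41 j hj y τ hs).1, expCfg_iEta_eq_cfgExp]
  -- boundedness of the two weighted families and the gradient datum
  have hBa : Bdd L m η (-(1 : ℝ)) (fun j (b : Site d × Fin d) => SideTouches (Ω j) b.1 b.2) fun b => A' b.1 b.2 := by
    have e1 : (-(1 : ℝ)) = -((1 : ℕ) : ℝ) := by norm_num
    rw [e1]
    refine B8ScaledSupNorm.bdd_of_forall (c := α₂) fun j hj b hb => ?_
    have hs : 0 < (L : ℝ) ^ j * η := B8ScaledSupNorm.scale_pos hL1 hη j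
    rw [B8ScaledSupNorm.weight_neg_natCast L η 1 j, pow_one]
    calc (L : ℝ) ^ j * η * ‖A' b.1 b.2‖ ≤ (L : ℝ) ^ j * η * (α₂ * ((L : ℝ) ^ j * η)⁻¹) :=
        mul_le_mul_of_nonneg_left (hA'41 j hj b.1 b.2 hb).2 hs.le
      _ = α₂ := by field_simp
  have hU₀1 : ∀ x κ, U₀ x κ ∈ U1 𝔸 := fun x κ => unitaryUnits_le_U1 (hU₀ x κ)
  have hgrad : ∀ (y : Site d) (κ τ : Fin d), ‖covDerivFwd η U₀ κ (fun z => A' z τ) y‖ ≤ 2 * α₂ * η⁻¹ * η⁻¹ := by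
    intro y κ τ
    unfold covDerivFwd
    rw [norm_smul, norm_inv, Real.norm_eq_abs, abs_of_pos hη]
    have h1 : ‖conjR (U₀ y κ) (A' (y + e κ) τ) - A' y τ‖ ≤ α₂ * η⁻¹ + α₂ * η⁻¹ := by
      calc ‖conjR (U₀ y κ) (A' (y + e κ) τ) - A' y τ‖
          ≤ ‖conjR (U₀ y κ) (A' (y + e κ) τ)‖ + ‖A' y τ‖ := norm_sub_le _ _
        _ ≤ α₂ * η⁻¹ + α₂ * η⁻¹ := by
            rw [B8Ineq132.norm_conjR (hU₀1 y κ)]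
            exact add_le_add (hA'glob _ _) (hA'glob _ _)
    calc η⁻¹ * ‖conjR (U₀ y κ) (A' (y + e κ) τ) - A' y τ‖ ≤ η⁻¹ * (α₂ * η⁻¹ + α₂ * η⁻¹) :=
        mul_le_mul_of_nonneg_left h1 (by positivity)
      _ = 2 * α₂ * η⁻¹ * η⁻¹ := by ring
  have hBg : Bdd L m η (-(2 : ℝ)) (fun j (t : Fin d × Fin d × Site d) => SideTouches (Ω j) t.2.2 t.2.1)
      (fun t => covDerivFwd η U₀ t.1 (fun z => A' z t.2.1) t.2.2) := by
    have e2 : (-(2 : ℝ)) = -((2 : ℕ) : ℝ) := by norm_num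
    rw [e2]
    refine B8ScaledSupNorm.bdd_of_forall (c := 2 * α₂ * ((L : ℝ) ^ m) ^ 2) fun j hj t _ => ?_
    rw [B8ScaledSupNorm.weight_neg_natCast L η 2 j]
    have hLjm : (L : ℝ) ^ j ≤ (L : ℝ) ^ m := pow_le_pow_right₀ hLr hj
    have hLj0 : (0 : ℝ) ≤ (L : ℝ) ^ j := by positivity
    calc ((L : ℝ) ^ j * η) ^ 2 * ‖covDerivFwd η U₀ t.1 (fun z => A' z t.2.1) t.2.2‖
        ≤ ((L : ℝ) ^ j * η) ^ 2 * (2 * α₂ * η⁻¹ * η⁻¹) := mul_le_mul_of_nonneg_left (hgrad _ _ _) (by positivity)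
      _ = 2 * α₂ * ((L : ℝ) ^ j) ^ 2 := by field_simp
      _ ≤ 2 * α₂ * ((L : ℝ) ^ m) ^ 2 := by gcongr
  set g : ℝ := msup L m η (-(2 : ℝ)) (fun j (t : Fin d × Fin d × Site d) => SideTouches (Ω j) t.2.2 t.2.1)
      (fun t => covDerivFwd η U₀ t.1 (fun z => A' z t.2.1) t.2.2) with hg_def
  have hg0 : 0 ≤ g := B8ScaledSupNorm.msup_nonneg L m hη.le _ _ _
  have hg : ∀ j, j ≤ m → ∀ (y : Site d) (κ τ : Fin d), SideTouches (Ω j) y τ →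
      ((L : ℝ) ^ j * η) ^ 2 * ‖covDerivFwd η U₀ κ (fun z => A' z τ) y‖ ≤ g := by
    intro j hj y κ τ hs
    have h := B8ScaledSupNorm.weight_mul_norm_le_msup hBg hj (i := (κ, τ, y)) hs
    have hw : weight L η (-(2 : ℝ)) j = ((L : ℝ) ^ j * η) ^ 2 := by
      have e2 : (-(2 : ℝ)) = -((2 : ℕ) : ℝ) := by norm_num
      rw [e2, B8ScaledSupNorm.weight_neg_natCast L η 2 j]
    rw [hw] at h
    exact h
  -- PROPOSITION 3 at `m` levels for `A′` (n05-b's `prop3_norms_kLevel`)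
  obtain ⟨ha, -⟩ := prop3_normA_kLevel_src hd2 hη hL hU₀ hA'sa hα₀ hα₁ hα₂ hg0 hα3 hα4 h16 hd5 hsmall hc₃
    hB₀ hside h50 hC₂ h61 (hbox m hmk) h40₀ h40₁ (fun j hj y τ hs => (hA'41 j hj y τ hs).2) hg h42 h59a h59g
  -- pointwise on the socket bond, and back to `A`
  have hpt := B8ScaledSupNorm.norm_le_of_msup_le hL1 hη hBa ha hj₀ (i := b₀) hb₀
  rw [Real.rpow_neg_one] at hpt
  obtain ⟨hAA, -, -⟩ := hsock j₀ hj₀ b₀.1 b₀.2 hb₀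
  rw [← hAA]
  exact hpt.trans (mul_le_mul_of_nonneg_right hc (by positivity))

end Reset

/-! ## §4 Theorem 4's existence clause at all levels for an ARBITRARY gauge predicate `Lan`, with the sourced reset — Theorem 8's existence core -/

section Composition

variable {𝔸 : Type*} [CStarAlgebra 𝔸] [Nontrivial 𝔸]

/-- **THEOREM 4's EXISTENCE INDUCTION AT ALL LEVELS, GAUGE TRANSFORMATIONS CARRIED BY Ω₀, ARBITRARY GAUGE PREDICATE `Lan`, SOURCED RESET** —
`B8Thm4SupportLocal.thm4_exists_all_levels_supp` at `E j :=` the sides touching `Ω_j`, `S := Ω 0`, with `hP3 := hP3_gaugeFixed_of_b9_src` and the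
(1.42) clause `B8Eq142KLevelLocal.H42_of_inAx` (both `Lan`-generic).  CONCLUSION: for every `m ≤ k` a unitary-valued `u` with `u = 1` off `Ω₀`,
(1.29) at `m` levels, `W = U′^{u⁻¹}` with `Lan m W` (`m ≥ 1`) and `W_b = e^{iηA_b}`, `A_b` self-adjoint, `‖A_b‖ ≤ c⋆(Lʲη)⁻¹` on the sides touching
`Ω_j`, `j ≤ m`, for ANY `c⋆ ≥ 5dLB₀(α₀ + α₁) + T_a + T_g` inside the windows.  REMAINING HYPOTHESES: Prop. 5's sockets AT `Lan` (`hP5base`,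
`hP5`), the SOURCED in-edge `H59src`, (1.33)/(1.34)/axial/(1.35)/(1.66)₀, geometry, windows.  At `Lan := IsLandau138W`, `T = 0` this is
`thm4_exists_all_levels_supp_landau138`; at `Lan := B8Eq138LandauZd.IsLandau146W … f` it is THEOREM 8's existence core ((1.146) with the
(1.62)-shape), the first brick of `B8Thm8Surviving.Thm8SurvivingAt` on the concrete carriers.
[cite: Balaban1985RegularSpaces, Thm 8 (1.146) p.101, Thm 4 p.88, (1.38) p.82, Prop. 3 p.87, Prop. 5 p.94, pp.94–95] -/
theorem thm4_exists_all_levels_supp_src (hd2 : 2 ≤ d) {η : ℝ} (hη : 0 < η) {L : ℕ} (hL : 2 ≤ L) (k : ℕ)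
    {U₀ U' : Site d → Fin d → 𝔸ˣ} (hU₀ : ∀ x κ, U₀ x κ ∈ unitaryUnits 𝔸) (hU' : ∀ x κ, U' x κ ∈ unitaryUnits 𝔸)
    {α₀ α₁ α₄ B₀ cstar a : ℝ} (hα₀ : 0 < α₀) (hα₁ : 0 < α₁) (hα₄ : 0 ≤ α₄) (hB₀ : 0 ≤ B₀)
    {Ta Tg : ℝ} (hTa : 0 ≤ Ta) (hTg : 0 ≤ Tg) (hc : 5 * d * L * B₀ * (α₀ + α₁) + (Ta + Tg) ≤ cstar)
    (hs₁ : α₄ ≤ 1 / 84) (hs₂ : L * cstar ≤ 1 / 12) (ha : a ≤ 1 / 4) (ha2 : 2 * a ≤ cstar)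
    (hα3 : C0 d * α₀ ≤ 1 / 3) (hα4 : 4 * α₀ ≤ c2' d L)
    (h16 : 16 * (2 * (L * cstar) + 8 * α₄) ≤ 1) (hd5 : 5 * (2 * (L * cstar) + 8 * α₄) * ((d : ℝ) - 1) ≤ 4)
    (hsmall : Real.exp (4 * (800 * ((d : ℝ) + 1) ^ 2 * ((d : ℝ) + 4)) * α₀)
      * (1 + 8 * (131072 * ((d : ℝ) + 1) ^ 2) * (2 * (L * cstar) + 8 * α₄)) ≤ 2)
    (hc₃ : 2 * (2 * (L * cstar) + 8 * α₄) ≤ c3 d L) (hside : 36 * d * B₀ * (2 * (L * cstar) + 8 * α₄) ≤ 1 / 2)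
    (h50 : 50 * d * (2 * (L * cstar) + 8 * α₄) ≤ 1) (hsmall₁ : (d : ℝ) * L * α₁ ≤ 1 / 8)
    {C₂ : ℝ} (hC₂ : 8 * (131072 * ((d : ℝ) + 1) ^ 2) * Real.exp (4 * (800 * ((d : ℝ) + 1) ^ 2 * ((d : ℝ) + 4)) * α₀) ≤ C₂)
    (h61 : 2 * (2 * (L * cstar) + 8 * α₄) ^ 2 + 20 * d * α₀ * (2 * (L * cstar) + 8 * α₄)
      + 2 * C₂ * (2 * (L * cstar) + 8 * α₄) ^ 2 ≤ α₀ + α₁)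
    (Ω : ℕ → Set (Site d)) (hΩ : ∀ j, Ω (j + 1) ⊆ Ω j) (Λs : ℕ → ℕ → Set (Site d)) (Λb : ℕ → ℕ → Set (Site d × Fin d))
    (hbox : ∀ m, m ≤ k → ∀ j, j ≤ m → ∀ c ∈ Λb m j, ∀ x, InBox (loK L j c.1) (bondHiK L j c.1 c.2) x → x ∈ Ω j)
    (hclass : ∀ m, m ≤ k → ∀ j, j ≤ m → ∀ c ∈ Λb m j,
      (c.1 ∈ Λs m j ∧ c.1 + e c.2 ∈ Λs m j) ∨
      (∃ j', j = j' + 1 ∧ (∀ x, (L : ℤ) • c.1 ≤ x → x ≤ (L : ℤ) • c.1 + blockTop L → x ∈ Λs m j') ∧ c.1 + e c.2 ∈ Λs m j) ∨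
      (∃ j', j = j' + 1 ∧ c.1 ∈ Λs m j ∧ (∀ x, (L : ℤ) • (c.1 + e c.2) ≤ x → x ≤ (L : ℤ) • (c.1 + e c.2) + blockTop L → x ∈ Λs m j')))
    (h33 : InAk L k η α₀ Ω U₀) (h34 : InAk L k η α₀ Ω (mulCfg U' U₀))
    (hAx : ∀ m, m ≤ k → InAx L m (Λs m) U₀ (mulCfg U' U₀))
    (h135 : ∀ j, j ≤ k → ∀ (z : Site d) (μ : Fin d), (∀ x, InBox (loK L j z) (bondHiK L j z μ) x → x ∈ Ω j) →
      ‖(avgIter L (mulCfg U' U₀) j z μ : 𝔸) - (avgIter L U₀ j z μ : 𝔸)‖ ≤ α₁)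
    (h66 : ∀ b ∈ {b : Site d × Fin d | SideTouches (Ω 0) b.1 b.2}, ‖((U' b.1 b.2 : 𝔸ˣ) : 𝔸) - 1‖ ≤ a)
    (Lan : ℕ → (Site d → Fin d → 𝔸ˣ) → Prop)
    (hP5base : ∃ (v : Site d → 𝔸ˣ) (lam : Site d → 𝔸), (∀ x, v x ∈ unitaryUnits 𝔸) ∧ (∀ x, x ∉ Ω 0 → v x = 1) ∧
        (∀ j, j ≤ 1 → ∀ b ∈ {b : Site d × Fin d | SideTouches (Ω j) b.1 b.2}, (v b.1 : 𝔸) = ((gaugeExp lam b.1 : 𝔸ˣ) : 𝔸) ∧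
          (v (b.1 + e b.2) : 𝔸) = ((gaugeExp lam (b.1 + e b.2) : 𝔸ˣ) : 𝔸)) ∧
        (∀ j, j ≤ 1 → ∀ b ∈ {b : Site d × Fin d | SideTouches (Ω j) b.1 b.2},
          ‖lam b.1‖ ≤ α₄ ∧ ((L : ℝ) ^ j * η) * ‖covDerivFwd η U₀ b.2 lam b.1‖ ≤ α₄) ∧
        Lan 1 (mgauge U₀ v⁻¹ U') ∧ Restr129 L 1 (Λs 1) U₀ ((1 : Site d → 𝔸ˣ) * v))
    (hP5 : ∀ m, 1 ≤ m → m < k → ∀ (u₁ : Site d → 𝔸ˣ) (U₁ : Site d → Fin d → 𝔸ˣ) (A : Site d → Fin d → 𝔸),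
      (∀ x, u₁ x ∈ unitaryUnits 𝔸) → (∀ x, x ∉ Ω 0 → u₁ x = 1) → mgauge U₀ u₁ U₁ = U' → Restr129 L m (Λs m) U₀ u₁ →
      Lan m U₁ →
      (∀ j, j ≤ m → ∀ b ∈ {b : Site d × Fin d | SideTouches (Ω j) b.1 b.2},
        U₁ b.1 b.2 = cfgExp η A b.1 b.2 ∧ IsSelfAdjoint (A b.1 b.2) ∧ ‖A b.1 b.2‖ ≤ cstar * ((L : ℝ) ^ j * η)⁻¹) →
      ∃ (v : Site d → 𝔸ˣ) (lam : Site d → 𝔸), (∀ x, v x ∈ unitaryUnits 𝔸) ∧ (∀ x, x ∉ Ω 0 → v x = 1) ∧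
        (∀ j, j ≤ m + 1 → ∀ b ∈ {b : Site d × Fin d | SideTouches (Ω j) b.1 b.2}, (v b.1 : 𝔸) = ((gaugeExp lam b.1 : 𝔸ˣ) : 𝔸) ∧
          (v (b.1 + e b.2) : 𝔸) = ((gaugeExp lam (b.1 + e b.2) : 𝔸ˣ) : 𝔸)) ∧
        (∀ j, j ≤ m + 1 → ∀ b ∈ {b : Site d × Fin d | SideTouches (Ω j) b.1 b.2},
          ‖lam b.1‖ ≤ α₄ ∧ ((L : ℝ) ^ j * η) * ‖covDerivFwd η U₀ b.2 lam b.1‖ ≤ α₄) ∧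
        Lan (m + 1) (mgauge U₀ v⁻¹ U₁) ∧ Restr129 L (m + 1) (Λs (m + 1)) U₀ (u₁ * v))
    (H59src : ∀ m, 1 ≤ m → m ≤ k → ∀ (u : Site d → 𝔸ˣ) (W : Site d → Fin d → 𝔸ˣ) (A' : Site d → Fin d → 𝔸),
      (∀ x, u x ∈ unitaryUnits 𝔸) → mgauge U₀ u W = U' → Restr129 L m (Λs m) U₀ u → Lan m W →
      (∀ y τ, IsSelfAdjoint (A' y τ)) →
      (∀ j, j ≤ m → ∀ y τ, SideTouches (Ω j) y τ →
        W y τ = cfgExp η A' y τ ∧ ‖A' y τ‖ ≤ (2 * (L * cstar) + 8 * α₄) * ((L : ℝ) ^ j * η)⁻¹) →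
      (∀ y τ, (∀ j, j ≤ m → ¬ SideTouches (Ω j) y τ) → A' y τ = 0) →
      msup L m η (-(1 : ℝ)) (fun j (b : Site d × Fin d) => SideTouches (Ω j) b.1 b.2) (fun b => A' b.1 b.2)
          ≤ B₀ * (bondNorm L m η (-(3 : ℝ)) Ω (fun x μ => Jcur η U₀ A' μ x)
            + wsup 1 (fun p : {p : ℕ × (Site d × Fin d) // p.1 ≤ m ∧ p.2 ∈ Λb m p.1} =>
                linCovIter L U₀ (iEta η A') p.1.1 p.1.2.1 p.1.2.2)) + Ta ∧
        msup L m η (-(2 : ℝ)) (fun j (t : Fin d × Fin d × Site d) => SideTouches (Ω j) t.2.2 t.2.1)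
            (fun t => covDerivFwd η U₀ t.1 (fun z => A' z t.2.1) t.2.2)
          ≤ B₀ * (bondNorm L m η (-(3 : ℝ)) Ω (fun x μ => Jcur η U₀ A' μ x)
            + wsup 1 (fun p : {p : ℕ × (Site d × Fin d) // p.1 ≤ m ∧ p.2 ∈ Λb m p.1} =>
                linCovIter L U₀ (iEta η A') p.1.1 p.1.2.1 p.1.2.2)) + Tg) :
    ∀ m, m ≤ k → ∃ u : Site d → 𝔸ˣ, (∀ x, u x ∈ unitaryUnits 𝔸) ∧ (∀ x, x ∉ Ω 0 → u x = 1) ∧ Restr129 L m (Λs m) U₀ u ∧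
      ∃ W : Site d → Fin d → 𝔸ˣ, mgauge U₀ u W = U' ∧ (1 ≤ m → Lan m W) ∧
        ∃ A : Site d → Fin d → 𝔸, ∀ j, j ≤ m → ∀ b ∈ {b : Site d × Fin d | SideTouches (Ω j) b.1 b.2},
          W b.1 b.2 = cfgExp η A b.1 b.2 ∧ IsSelfAdjoint (A b.1 b.2) ∧ ‖A b.1 b.2‖ ≤ cstar * ((L : ℝ) ^ j * η)⁻¹ := by
  have hL1 : 1 ≤ L := le_trans (by norm_num) hL
  have hcstar : 0 ≤ cstar := le_trans (by positivity) hc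
  have hα₂ : 0 ≤ 2 * (L * cstar) + 8 * α₄ := by positivity
  have hE : ∀ j, {b : Site d × Fin d | SideTouches (Ω (j + 1)) b.1 b.2} ⊆ {b : Site d × Fin d | SideTouches (Ω j) b.1 b.2} :=
    fun j b hb => B8Eq140Level.sideTouches_mono (hΩ j) hb
  exact thm4_exists_all_levels_supp hL1 hη (Ω 0) hU₀ hU' hcstar hα₄ hs₁ hs₂ ha ha2
    (fun j => {b : Site d × Fin d | SideTouches (Ω j) b.1 b.2}) hE h66 Λs Lan
    hP5base hP5
    (hP3_gaugeFixed_of_b9_src hd2 hη hL k hU₀ hU' hα₀ hα₁.le hα₄ hB₀ hTa hTg hc hα3 hα4 h16 hd5 hsmall hc₃ hside h50 hC₂ h61 Ω Λs Λb hbox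
      h33 h34 Lan
      (B8Eq142KLevelLocal.H42_of_inAx hd2 hη hL k hU₀ hα₀ hα₁ hα₂ hα3 hα4 h16 hsmall hc₃ hsmall₁ Ω hΩ Λs Λb hbox hclass h33 h34
        hAx h135 Lan)
      H59src)

end Composition

/-! ## §5 Theorem 4's uniqueness clause for an ARBITRARY gauge predicate `Lan` — Theorem 8's uniqueness core («exactly one», p. 101) -/

section Unique

variable {𝔸 : Type*} [CStarAlgebra 𝔸] [Nontrivial 𝔸]
variable {L k : ℕ} {η : ℝ} {Ω : ℕ → Set (Site d)} {Λ : ℕ → Set (Site d)} {U₀ U' : Site d → Fin d → 𝔸ˣ} {α₀ αP c : ℝ}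
  {u₁ u₂ : Site d → 𝔸ˣ}

/-- **THEOREM 4's UNIQUENESS CLAUSE IN THE LEAF'S SHAPE, ARBITRARY GAUGE PREDICATE `Lan`** — `B8Thm4AtLandau138.thm4_unique_leafShape_landau138`
VERBATIM with `IsLandau138W L k η (Ω 0) Λ U₀` replaced by a parameter `Lan` (the underlying `B8Thm4UniqueLocal.thm4_unique_of_agree` is
`Lan`-generic: the gauge condition is consumed only by Prop. 5's uniqueness socket `hP5u`): two unitary `u₁`, `u₂` with (1.29), `Lan (U′^{u_i⁻¹})`
and the (1.62)-shape on the bonds of `Ω_j` AGREE on every constraint tower.  At `Lan := IsLandau146W … f` this is THEOREM 8's «exactly one»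
(p. 101) on the towers, modulo Prop. 5's uniqueness for the sourced equation. [cite: Balaban1985RegularSpaces, Thm 8 p.101 («exactly one»), Thm 4 p.88, proof p.95 (1.112), Prop. 5 (1.109) p.94] -/
theorem thm4_unique_leafShape_lan (hd2 : 2 ≤ d) (hL : 2 ≤ L) (hη : 0 < η)
    (hU₀ : ∀ x κ, U₀ x κ ∈ unitaryUnits 𝔸) (hU' : ∀ x κ, U' x κ ∈ unitaryUnits 𝔸)
    (hu₁ : ∀ x, u₁ x ∈ unitaryUnits 𝔸) (hu₂ : ∀ x, u₂ x ∈ unitaryUnits 𝔸)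
    (hα : 0 < α₀) (hα3 : C0 d * α₀ ≤ 1 / 3) (hα4 : 4 * α₀ ≤ c2' d L) (hc : 0 ≤ c)
    (hsmall : Real.exp (4 * (800 * ((d : ℝ) + 1) ^ 2 * ((d : ℝ) + 4)) * α₀) * (1 + 8 * (131072 * ((d : ℝ) + 1) ^ 2) * c) ≤ 2)
    (hc₃ : 2 * c ≤ c3 d L) (hsm : 2048 * (d : ℝ) * c ≤ 1) (hα₃ : 40 * d * c ≤ 1 / 5000)
    (hαP : 0 < αP) (hαP3 : C0 d * αP ≤ 1 / 3) (hαP2 : 2 * αP ≤ c2' d L)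
    {cu : ℝ} (hcu₁ : 2 * (2 * (40 * d * c) + 2 * 1116 * (40 * d * c) ^ 2) < cu) (hcu₂ : 5 * c < cu)
    (h33 : InAk L k η α₀ Ω U₀) (h34 : InAk L k η αP Ω (U' * U₀)) (hAx : InAx L k Λ U₀ (U' * U₀))
    (htower : ∀ j, j ≤ k → ∀ y ∈ Λ j, ∀ x, InBox (tlo L y j) (thi L y j) x → x ∈ Ω j)
    (h129₁ : Restr129 L k Λ U₀ u₁) (h129₂ : Restr129 L k Λ U₀ u₂)
    (Lan : (Site d → Fin d → 𝔸ˣ) → Prop)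
    (hLan₁ : Lan (mgauge U₀ u₁⁻¹ U')) (hLan₂ : Lan (mgauge U₀ u₂⁻¹ U'))
    (h162₁ : ∃ A₁ : Site d → Fin d → 𝔸, ∀ j, j ≤ k → ∀ (x : Site d) (κ : Fin d), SideTouches (Ω j) x κ →
      mgauge U₀ u₁⁻¹ U' x κ = cfgExp η A₁ x κ ∧ ‖A₁ x κ‖ ≤ c * ((L : ℝ) ^ j * η)⁻¹)
    (h162₂ : ∃ A₂ : Site d → Fin d → 𝔸, ∀ j, j ≤ k → ∀ (x : Site d) (κ : Fin d), SideTouches (Ω j) x κ →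
      mgauge U₀ u₂⁻¹ U' x κ = cfgExp η A₂ x κ ∧ ‖A₂ x κ‖ ≤ c * ((L : ℝ) ^ j * η)⁻¹)
    (hP5u : ∀ (v w : Site d → 𝔸ˣ) (lam mu : Site d → 𝔸),
      (∀ j, j ≤ k → ∀ y ∈ Λ j, ∀ x : Site d, InBox (tlo L y j) (thi L y j) x →
        ((gaugeExp lam x : 𝔸ˣ) : 𝔸) = ((v x : 𝔸ˣ) : 𝔸) ∧ IsSelfAdjoint (lam x) ∧ ‖lam x‖ < cu ∧
          ∀ κ : Fin d, InBox (tlo L y j) (thi L y j) (x + e κ) → ((L : ℝ) ^ j * η) * ‖covDerivFwd η U₀ κ lam x‖ < cu) →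
      (∀ j, j ≤ k → ∀ y ∈ Λ j, ∀ x : Site d, InBox (tlo L y j) (thi L y j) x →
        ((gaugeExp mu x : 𝔸ˣ) : 𝔸) = ((w x : 𝔸ˣ) : 𝔸) ∧ IsSelfAdjoint (mu x) ∧ ‖mu x‖ < cu ∧
          ∀ κ : Fin d, InBox (tlo L y j) (thi L y j) (x + e κ) → ((L : ℝ) ^ j * η) * ‖covDerivFwd η U₀ κ mu x‖ < cu) →
      Lan (mgauge U₀ v⁻¹ (mgauge U₀ u₁⁻¹ U')) → Restr129 L k Λ U₀ (u₁ * v) →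
      Lan (mgauge U₀ w⁻¹ (mgauge U₀ u₁⁻¹ U')) → Restr129 L k Λ U₀ (u₁ * w) →
      ∀ j, j ≤ k → ∀ y ∈ Λ j, ∀ x : Site d, InBox (tlo L y j) (thi L y j) x → v x = w x) :
    ∀ j, j ≤ k → ∀ y ∈ Λ j, ∀ x : Site d, InBox (tlo L y j) (thi L y j) x → u₁ x = u₂ x := by
  have hL1 : 1 ≤ L := le_trans (by norm_num) hL
  have hd : 1 ≤ d := le_trans (by norm_num) hd2
  haveI : Nontrivial (Fin d) := Fin.nontrivial_iff_two_le.mpr hd2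
  obtain ⟨A₁, hA₁⟩ := h162₁
  obtain ⟨A₂, hA₂⟩ := h162₂
  -- a bond inside a tower `Bʲ(y) ⊂ Ω_j` is a side of a plaquette touching `Ω_j`
  have hside : ∀ j, j ≤ k → ∀ y ∈ Λ j, ∀ (x : Site d) (κ : Fin d), InBox (tlo L y j) (thi L y j) x →
      SideTouches (Ω j) x κ := by
    intro j hj y hy x κ hx
    obtain ⟨κ', hκ'⟩ := exists_ne κ
    exact sideTouches_of_bondTouches hκ' (Or.inl (htower j hj y hy x hx))
  exact thm4_unique_of_agree hd hL hL1 hη hU₀ hU' hu₁ hu₂ hα hα3 hα4 hc hsmall hc₃ hsm hα₃ hαP hαP3 hαP2 hcu₁ hcu₂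
    (fun j hj y hy => pdevOn_tower_lt_of_inAk hL1 hα h33 hj (htower j hj y hy))
    (fun j hj y hy => pdevOn_tower_lt_of_inAk hL1 hαP h34 hj (htower j hj y hy))
    hAx h129₁ h129₂ (mgauge_mgauge_inv U₀ U' u₁) (mgauge_mgauge_inv U₀ U' u₂)
    (fun j hj y hy x κ hx _ => (hA₁ j hj x κ (hside j hj y hy x κ hx)).1)
    (fun j hj y hy x κ hx _ => (hA₂ j hj x κ (hside j hj y hy x κ hx)).1)
    (fun j hj y hy x κ hx _ => (hA₁ j hj x κ (hside j hj y hy x κ hx)).2)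
    (fun j hj y hy x κ hx _ => (hA₂ j hj x κ (hside j hj y hy x κ hx)).2)
    Lan hLan₁ hLan₂ hP5u

/-- **THEOREM 4's UNIQUENESS CLAUSE AS AN EQUALITY `u₁ = u₂`, ARBITRARY GAUGE PREDICATE `Lan`** — `B8Thm4SupportLocal.thm4_unique_eq_landau138`
VERBATIM with `Lan` a parameter (gauge transformations carried by `Ω₀`: `u_i = 1` off `Ω₀`, the partition clause `hpart`).  At
`Lan := IsLandau146W … f`: Theorem 8's uniqueness among restricted competitors, modulo `hP5u` for the sourced equation.
[cite: Balaban1985RegularSpaces, Thm 8 p.101, Thm 4 p.88 («exactly one»), (1.29) p.81, proof p.95 (1.112), Prop. 5 (1.109) p.94] -/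
theorem thm4_unique_eq_lan (hd2 : 2 ≤ d) (hL : 2 ≤ L) (hη : 0 < η)
    (hU₀ : ∀ x κ, U₀ x κ ∈ unitaryUnits 𝔸) (hU' : ∀ x κ, U' x κ ∈ unitaryUnits 𝔸)
    (hu₁ : ∀ x, u₁ x ∈ unitaryUnits 𝔸) (hu₂ : ∀ x, u₂ x ∈ unitaryUnits 𝔸)
    (hα : 0 < α₀) (hα3 : C0 d * α₀ ≤ 1 / 3) (hα4 : 4 * α₀ ≤ c2' d L) (hc : 0 ≤ c)
    (hsmall : Real.exp (4 * (800 * ((d : ℝ) + 1) ^ 2 * ((d : ℝ) + 4)) * α₀) * (1 + 8 * (131072 * ((d : ℝ) + 1) ^ 2) * c) ≤ 2)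
    (hc₃ : 2 * c ≤ c3 d L) (hsm : 2048 * (d : ℝ) * c ≤ 1) (hα₃ : 40 * d * c ≤ 1 / 5000)
    (hαP : 0 < αP) (hαP3 : C0 d * αP ≤ 1 / 3) (hαP2 : 2 * αP ≤ c2' d L)
    {cu : ℝ} (hcu₁ : 2 * (2 * (40 * d * c) + 2 * 1116 * (40 * d * c) ^ 2) < cu) (hcu₂ : 5 * c < cu)
    (h33 : InAk L k η α₀ Ω U₀) (h34 : InAk L k η αP Ω (U' * U₀)) (hAx : InAx L k Λ U₀ (U' * U₀))
    (htower : ∀ j, j ≤ k → ∀ y ∈ Λ j, ∀ x, InBox (tlo L y j) (thi L y j) x → x ∈ Ω j)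
    (h129₁ : Restr129 L k Λ U₀ u₁) (h129₂ : Restr129 L k Λ U₀ u₂)
    (Lan : (Site d → Fin d → 𝔸ˣ) → Prop)
    (hLan₁ : Lan (mgauge U₀ u₁⁻¹ U')) (hLan₂ : Lan (mgauge U₀ u₂⁻¹ U'))
    (h162₁ : ∃ A₁ : Site d → Fin d → 𝔸, ∀ j, j ≤ k → ∀ (x : Site d) (κ : Fin d), SideTouches (Ω j) x κ →
      mgauge U₀ u₁⁻¹ U' x κ = cfgExp η A₁ x κ ∧ ‖A₁ x κ‖ ≤ c * ((L : ℝ) ^ j * η)⁻¹)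
    (h162₂ : ∃ A₂ : Site d → Fin d → 𝔸, ∀ j, j ≤ k → ∀ (x : Site d) (κ : Fin d), SideTouches (Ω j) x κ →
      mgauge U₀ u₂⁻¹ U' x κ = cfgExp η A₂ x κ ∧ ‖A₂ x κ‖ ≤ c * ((L : ℝ) ^ j * η)⁻¹)
    (hP5u : ∀ (v w : Site d → 𝔸ˣ) (lam mu : Site d → 𝔸),
      (∀ j, j ≤ k → ∀ y ∈ Λ j, ∀ x : Site d, InBox (tlo L y j) (thi L y j) x →
        ((gaugeExp lam x : 𝔸ˣ) : 𝔸) = ((v x : 𝔸ˣ) : 𝔸) ∧ IsSelfAdjoint (lam x) ∧ ‖lam x‖ < cu ∧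
          ∀ κ : Fin d, InBox (tlo L y j) (thi L y j) (x + e κ) → ((L : ℝ) ^ j * η) * ‖covDerivFwd η U₀ κ lam x‖ < cu) →
      (∀ j, j ≤ k → ∀ y ∈ Λ j, ∀ x : Site d, InBox (tlo L y j) (thi L y j) x →
        ((gaugeExp mu x : 𝔸ˣ) : 𝔸) = ((w x : 𝔸ˣ) : 𝔸) ∧ IsSelfAdjoint (mu x) ∧ ‖mu x‖ < cu ∧
          ∀ κ : Fin d, InBox (tlo L y j) (thi L y j) (x + e κ) → ((L : ℝ) ^ j * η) * ‖covDerivFwd η U₀ κ mu x‖ < cu) →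
      Lan (mgauge U₀ v⁻¹ (mgauge U₀ u₁⁻¹ U')) → Restr129 L k Λ U₀ (u₁ * v) →
      Lan (mgauge U₀ w⁻¹ (mgauge U₀ u₁⁻¹ U')) → Restr129 L k Λ U₀ (u₁ * w) →
      ∀ j, j ≤ k → ∀ y ∈ Λ j, ∀ x : Site d, InBox (tlo L y j) (thi L y j) x → v x = w x)
    (hpart : ∀ x, x ∈ Ω 0 → ∃ j, j ≤ k ∧ ∃ y ∈ Λ j, InBox (tlo L y j) (thi L y j) x)
    (hu₁S : ∀ x, x ∉ Ω 0 → u₁ x = 1) (hu₂S : ∀ x, x ∉ Ω 0 → u₂ x = 1) :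
    u₁ = u₂ := by
  have htw := thm4_unique_leafShape_lan hd2 hL hη hU₀ hU' hu₁ hu₂ hα hα3 hα4 hc hsmall hc₃ hsm hα₃ hαP hαP3 hαP2 hcu₁ hcu₂ h33
    h34 hAx htower h129₁ h129₂ Lan hLan₁ hLan₂ h162₁ h162₂ hP5u
  funext x
  by_cases hx : x ∈ Ω 0
  · obtain ⟨j, hj, y, hy, hxy⟩ := hpart x hx
    exact htw j hj y hy x hxy
  · rw [hu₁S x hx, hu₂S x hx]

end Unique

#print axioms apriori_160_src
#print axioms prop3_normA_kLevel_src
#print axioms hP3_gaugeFixed_of_b9_src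
#print axioms thm4_exists_all_levels_supp_src
#print axioms thm4_unique_leafShape_lan
#print axioms thm4_unique_eq_lan

end Literature.MathematicalPhysics.QuantumFieldTheory.Balaban1983to89.B8Prop3GaugeFixedKLevelSrc

end
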